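import Summits.QuantumFields.BalabanUV.T4Continuum.Spine.NE5.TwoRunTorusNE5Final8

/-!
# BalabanUVNodes ∕ N18 from the END of row NE5 — node N18 = NE5 in the K4 family shape at the coupling-READING read-out
# of the torus carriers, DIRECTLY from `TwoRunTorusNE5Final8.ne5_end_final_all8` applied per member of run B's
# first-coupling family and per coupling sequence (Track A, DAG node N18; cluster K4 «SpineRates»)

HONEST FRAMING.  Count-neutral quantifier bookkeeping over the LANDED END of the NE5 cell chain; NOT a node discharge (no
NODE 00 stage pins node U3's carriers; NODE O's one-step records are instance 0∕1); NE5 NOT IN PRINT and NOT PROVED (print: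
[Balaban1987RG1] Thm 1 p. 259, uniformity in ε only); one finite four-torus programme at fixed ε; nothing continuum ∕ ℝ⁴ ∕
OS ∕ mass-gap ∕ Clay.  0 `sorry`, 0 `def`, standard axioms.

WHAT THIS FILE RECORDS.  Cluster K4 asks N18 as `∀ b ∈ ]0, γ], NE5 EA (EB b) W κ θ C₅` with ONE rate `θ` and ONE
constant `C₅` for all members `b`, on carriers SHARED with N22 ∕ N17 ∕ (D4), whose functionals must READ the coupling
sequence (companion `BalabanUVNodesN18Coherence` §3–§4).  The END of row NE5 (T53 `ne5_end_final_all8`, cell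
`pub-balaban-gaps` seat ne5 gen 15) is quantified `∀ L ≥ 8 ∃ c ∀ letters ∃ sizes ∀ (θ, s, R_σ0, M) ∃ (w, α, r_P) ∀ DATA →
NE5`: every ∃-export precedes the DATA.  Hence a producer whose one-step DATA are indexed by the member `b` and by the
coupling sequence `g ∈ W′` — record data `𝒦 b g j Z t φ`, Γ-operators, characteristic functions, potentials, activities
`H b g`, output pencils `E b g` — and satisfy the END's ∀-part for EACH `(b, g)` with the SAME exports, obtains the K4
family shape at the coupling-reading read-out `g ↦ reFunctional N W (E₀ g) g`, `b ↦ (g ↦ reFunctional N W (E₁ b g) g)`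
with the END's letters `κ′ = (1−10δ)½Lκ`, rate `θ`, constant `2A₂C₃ε₁∕s` UNIFORM in `b` and `g` — theorem
`n18_family_of_end8` below: the END's statement with its ∀-part re-indexed by `(b, g)` (every data hypothesis asked only
for `b ∈ ]0, γ]`, `g ∈ W′`), the members identified with the coupling-indexed outputs `E₀ g j = E b g j 0`,
`E₁ b g j = E b g j 1` on the spaces, and the conclusion in the K4 shape.  Also recorded (dag-ref-B READ #3, A6): the statement of record has content only for `θ < 1` —
`ne5_of_decayBounds_one_le`.  Nothing else changes: in-edges as in the END
(NODE O = the per-term pencil records at the window scales `θ^j < s`, radius `max 2 (s∕θ^j)·C_R` — by the companion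
`BalabanUVNodesN18Knit.window_radius_le_reach` this is within T42's reach `s₀∕r_j` under rows NE2∕NE3's rate `r_j ≤ C₂θ^j`
once `s ≤ s₀∕(2C₂C_R)`; N10 ∕ NODE A = each member's one-run bound at every scale; adapter data; NODE 00 = the carriers).

Sources: T. Bałaban, CMP **109** (1987) [Balaban1987RG1] p. 251, (0.24)–(0.25) p. 257, Thm 1 p. 259; CMP **116** (1988)
[Balaban1988RG2Cluster] p. 13, p. 15, (2.13)–(2.26) pp. 14–17, (2.18) p. 16, (2.31) p. 18, (2.38) p. 20, (2.41) p. 21;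
CMP **99** (1985) [Balaban1985BackgroundPropagators] Thm 3.7 p. 409, Thm 3.10 (3.107)–(3.108) p. 416; C. King, CMP **102**
(1986) [King1986] p. 665.  Nothing here is a claim about the Yang–Mills mass gap.
-/

noncomputable section

namespace Summit.QuantumFields.YangMills.BalabanUVNodes.N18End

open Matrix Metric Set Finset
open Literature.MathematicalPhysics.QuantumFieldTheory.Balaban1983to89
open Literature.MathematicalPhysics.QuantumFieldTheory.Balaban1983to89.T4OutputRate (Carriers Functional DecayBound NE5)
open Literature.MathematicalPhysics.QuantumFieldTheory.Balaban1983to89.TreeLengthTorus (TPt TDom tsys)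
open Literature.MathematicalPhysics.QuantumFieldTheory.Balaban1983to89.TreeLengthTorusGeometry (TTouch)
open Literature.MathematicalPhysics.QuantumFieldTheory.Balaban1983to89.TreeLengthTorusTransfer (tclosure)
open Literature.MathematicalPhysics.QuantumFieldTheory.Balaban1983to89.B13Lemma3TorusData (TBond)
open Literature.MathematicalPhysics.QuantumFieldTheory.Balaban1983to89.B13Lemma3Torus (TwoTorusStep)
open Literature.MathematicalPhysics.QuantumFieldTheory.Balaban1983to89.B13Lemma3TorusTerms (terms weight Z0)
open Literature.MathematicalPhysics.QuantumFieldTheory.Balaban1983to89.B13Term214 (core214 F214 term214)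
open Literature.MathematicalPhysics.QuantumFieldTheory.Balaban1983to89.B13Bound143 (invTau)
open Literature.MathematicalPhysics.QuantumFieldTheory.Balaban1983to89.B5TorusCover (UT)
open Literature.MathematicalPhysics.QuantumFieldTheory.Balaban1983to89.B13Resummation (locE)
open Literature.MathematicalPhysics.QuantumFieldTheory.Balaban1983to89.B13TermWalkData
  (WalkConsts TermKernels TermWalkData)
open Summit.QuantumFields.BalabanUV.T4Continuum.Spine.NE5.TwoRunTorusNE5 (torusCarriers reFunctional)
open Summit.QuantumFields.BalabanUV.T4Continuum.Spine.NE5.TwoRunTorusNE5Final8 (ne5_end_final_all8)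

/-! ## Guard on the rate letter (referee A6, dag-ref-B READ #3): the node has content only for `θ < 1` -/

/-- **A6 IN KERNEL FORM.**  The statement of record `NE5 EA EB W κ θ C₅` carries no `θ < 1`: if BOTH runs obey the printed
one-run decay bound (0.25) ∕ (1.18) with constant `E₀ ≥ 0` ([Balaban1987RG1] p. 257, p. 263 — N10's (2.41) per run) and
`1 ≤ θ`, then `NE5 EA EB W κ θ (2E₀)` holds by the triangle inequality alone.  So a pin of N18's letters must carry
`θ < 1` (print's model: `θ = L^{−γ}`, [King1986] (3.73) p. 665); in the END below `θ` is the PRODUCER's (`∀ θ > 0`), i.e.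
the rate of rows NE2∕NE3. [cite: Balaban1987RG1, (0.25) p.257, (1.18) p.263; King1986, (3.73) p.665] -/
theorem ne5_of_decayBounds_one_le {C : Carriers} {EA : Functional C C.BgA} {EB : Functional C C.BgB}
    {W : Set (ℕ → ℝ)} {E₀ κ θ : ℝ} (hA : DecayBound EA W E₀ κ) (hB : DecayBound EB W E₀ κ) (hE₀ : 0 ≤ E₀)
    (hθ : 1 ≤ θ) : NE5 EA EB W κ θ (2 * E₀) := by
  intro g hg U X
  have h1 := hA g hg (C.transport U) X
  have h2 := hB g hg U X
  have he : 0 ≤ E₀ * Real.exp (-(κ * C.d X)) := mul_nonneg hE₀ (Real.exp_pos _).le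
  have hθj : 1 ≤ θ ^ C.scale X := one_le_pow₀ hθ
  calc |EA g (C.transport U) X - EB g U X| ≤ |EA g (C.transport U) X| + |EB g U X| := abs_sub _ _
    _ ≤ 2 * (E₀ * Real.exp (-(κ * C.d X))) * 1 := by linarith
    _ ≤ 2 * (E₀ * Real.exp (-(κ * C.d X))) * θ ^ C.scale X := by gcongr
    _ = 2 * E₀ * θ ^ C.scale X * Real.exp (-(κ * C.d X)) := by ring

/-! ## N18 in the K4 family shape from the END of row NE5 -/

variable {L : ℕ} [NeZero L]

open Classical in
/-- Two output families that agree ON THE SPACES have the same real read-out (`reFunctional` reads a family only on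
`(W j).sp2 X`). [folklore] -/
theorem reFunctional_congr (N : ℕ → ℕ) [∀ j, NeZero (N j)] (W : (j : ℕ) → TwoTorusStep 4 L (N j))
    {E E' : (j : ℕ) → TDom 4 (N j) → (W j).Φ → ℂ}
    (h : ∀ (j : ℕ) (X : TDom 4 (N j)) (φ : (W j).Φ), φ ∈ (W j).sp2 X → E j X φ = E' j X φ) (g : ℕ → ℝ)
    (U : (torusCarriers N W).BgB) (X : (torusCarriers N W).Dom) :
    reFunctional N W E g U X = reFunctional N W E' g U X := by
  unfold reFunctional
  split_ifs with hU
  · rw [h _ _ _ hU]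
  · rfl

open Classical in
/-- **N18 IN THE K4 FAMILY SHAPE AT THE COUPLING-READING READ-OUT, FROM THE END OF ROW NE5.**  `ne5_end_final_all8`
with its ∀-part re-indexed by the member `b ∈ ]0, γ]` of run B's first-coupling family and the coupling sequence
`g ∈ W′` (every data hypothesis asked only there), the pencil members identified on the spaces with coupling-indexed
outputs `E₀ g` (run A) and `E₁ b g` (run B), and the conclusion
`∀ b ∈ ]0, γ], NE5 (g ↦ reFunctional N W (E₀ g) g) (g ↦ reFunctional N W (E₁ b g) g) W′ ((1−10δ)½Lκ) θ (2A₂C₃ε₁∕s)` —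
ONE rate and ONE constant for all members and couplings, because the END exports `c`, the size constants and the
packages BEFORE the data.  Proof: the END per `(b, g)`, read at `g`.
[cite: Balaban1987RG1, p.251, (0.24)–(0.25) p.257, Thm 1 p.259; Balaban1988RG2Cluster, p.13, p.15, (2.13)–(2.26) pp.14–17, (2.18) p.16, (2.31) p.18, (2.38) p.20, (2.41) p.21; Balaban1985BackgroundPropagators, Thm 3.7 p.409, Thm 3.10 (3.107)–(3.108) p.416; King1986, p.665] -/
theorem n18_family_of_end8 :
    ∀ (L : ℕ) [NeZero L], 8 ≤ L →
      ∃ c : B13.Consts, c.L = L ∧ 1 ≤ c.κ₁ ∧ (∀ d : ℝ, 0 ≤ d → 0 < invTau c d ∧ invTau c d ≤ 1 / 2) ∧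
      ∀ {ν : ℕ} {Nf : ℕ → Fin ν → ℕ} [∀ j i, NeZero (Nf j i)],
      ∀ {KΓ KE KC ε κ : ℝ}, 0 ≤ KΓ → 0 ≤ KE → 0 ≤ KC → 0 < ε → 0 < κ → ∀ (m : ℕ) {nΛ nN : ℝ}, 0 ≤ nΛ → 0 ≤ nN →
      ∃ (CR Cσ γ₂ a₂₀ w₀ : ℝ), 2 < CR ∧ 0 < γ₂ ∧ 0 ≤ a₂₀ ∧ 0 < w₀ ∧
      ∀ {θ s : ℝ}, 0 < θ → 0 < s → ∀ (Rσ₀ : ℝ) (M : ℕ) [NeZero M],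
      ∃ (w : ℕ → WalkConsts) (α : ℕ → ℝ) (rP : ℝ),
      (∀ j, (w j).Admissible (α j) Rσ₀) ∧ (∀ j, 1 < α j) ∧ (∀ j, θ ^ j < s → s / θ ^ j ≤ α j) ∧
      (∀ j, (w j).KbarΓ = KΓ ∧ (w j).KbarE = KE ∧ (w j).KbarC = KC ∧ (w j).kap = κ ∧ (w j).ε = ε) ∧
      (∀ j, α j = max 2 (s / θ ^ j)) ∧ (∀ j, (w j).R = max 2 (s / θ ^ j) * CR) ∧ (∀ j, (w j).Rσ = max Rσ₀ Cσ) ∧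
      ∀ (N : ℕ → ℕ) [∀ j, NeZero (N j)] (W : (j : ℕ) → TwoTorusStep 4 L (N j)) (γ : ℝ) (W' : Set (ℕ → ℝ))
        {Uτ : (j : ℕ) → TDom 4 (L * N j) → Set ℂ}, (∀ j Y, IsOpen (Uτ j Y)) →
        (∀ j, ∀ Y : TDom 4 (L * N j), closedBall (0 : ℂ) ((invTau c ((tsys 4 (L * N j)).dj Y))⁻¹) ⊆ Uτ j Y) →
        ∀ {r : ℝ}, 0 < r → r ≤ Real.exp c.κ₁ - 1 → (∀ j Y, ∀ ζ ∈ Set.uIcc (0 : ℝ) 1, closedBall (ζ : ℂ) r ⊆ Uτ j Y) →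
        ∀ (lZ : (j : ℕ) → TDom 4 (N j) → Finset (TDom 4 (L * N j)) × Finset (TBond 4 M (L * N j)) → List (TPt 4 (N j))),
        (∀ j Z t, (lZ j Z t).Nodup ∧ (lZ j Z t).toFinset = Z.1 \ tclosure L (N j) (Z0 M t)) →
        ∀ (lD : (j : ℕ) → Finset (TDom 4 (L * N j)) × Finset (TBond 4 M (L * N j)) → List (TDom 4 (L * N j))),
        (∀ j t, (lD j t).Nodup ∧ (lD j t).toFinset = t.1) →
        -- the one-step DATA, indexed by the member `b` and the coupling sequence `g`
        ∀ (𝒦 : (b : ℝ) → (g : ℕ → ℝ) → (j : ℕ) → (Z : TDom 4 (N j)) →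
            Finset (TDom 4 (L * N j)) × Finset (TBond 4 M (L * N j)) → (W j).Φ →
            TermKernels ({ c with κ₁ := c.κ₁ + 1 } : B13.Consts) 4 (N j) ν (Nf j) ℂ)
          [∀ b g j Z t φ, Fintype (𝒦 b g j Z t φ).C₀] [∀ b g j Z t φ, DecidableEq (𝒦 b g j Z t φ).C₀],
        (∀ b : ℝ, 0 < b → b ≤ γ → ∀ g ∈ W', ∀ j, θ ^ j < s → ∀ Z, ∀ t ∈ terms L M Z, ∀ φ, φ ∈ (W j).sp2 Z →
          TermWalkData (𝒦 b g j Z t φ) (w j)) →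
        ∀ (Γ : (b : ℝ) → (g : ℕ → ℝ) → (j : ℕ) → (Z : TDom 4 (N j)) →
            (t : Finset (TDom 4 (L * N j)) × Finset (TBond 4 M (L * N j))) → (φ : (W j).Φ) → ℂ → (TPt 4 (N j) → ℂ) →
            ((𝒦 b g j Z t φ).Λ ⊕ (𝒦 b g j Z t φ).C₀ → ℝ) → ((𝒦 b g j Z t φ).Λ → ℂ)),
        (∀ b : ℝ, 0 < b → b ≤ γ → ∀ g ∈ W', ∀ j, θ ^ j < s → ∀ Z, ∀ t ∈ terms L M Z, ∀ φ, φ ∈ (W j).sp2 Z →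
          ∀ z ∈ ball (0 : ℂ) (α j), ∀ σ : TPt 4 (N j) → ℂ, (∀ i, σ i ∈ ball (0 : ℂ) (Real.exp (c.κ₁ + 1))) →
            ∀ X : (𝒦 b g j Z t φ).Λ ⊕ (𝒦 b g j Z t φ).C₀ → ℝ,
              Γ b g j Z t φ z σ X = (𝒦 b g j Z t φ).G2 σ z *ᵥ fun i => (X i : ℂ)) →
        ∀ (χY₀ χcP : (b : ℝ) → (g : ℕ → ℝ) → (j : ℕ) → (Z : TDom 4 (N j)) →
            (t : Finset (TDom 4 (L * N j)) × Finset (TBond 4 M (L * N j))) → (φ : (W j).Φ) →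
            ((𝒦 b g j Z t φ).Λ → ℝ) → ℝ),
        (∀ b : ℝ, 0 < b → b ≤ γ → ∀ g ∈ W', ∀ j Z t φ Bf, 0 ≤ χY₀ b g j Z t φ Bf) →
        (∀ b : ℝ, 0 < b → b ≤ γ → ∀ g ∈ W', ∀ j Z t φ Bf, 0 ≤ χcP b g j Z t φ Bf) →
        ∀ (Dfam : (b : ℝ) → (g : ℕ → ℝ) → (j : ℕ) → TDom 4 (N j) →
            Finset (TDom 4 (L * N j)) × Finset (TBond 4 M (L * N j)) → Finset (TDom 4 (L * N j)))
          (Vk : (b : ℝ) → (g : ℕ → ℝ) → (j : ℕ) → (Z : TDom 4 (N j)) →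
            (t : Finset (TDom 4 (L * N j)) × Finset (TBond 4 M (L * N j))) → (φ : (W j).Φ) → ℂ → TDom 4 (L * N j) →
            ((𝒦 b g j Z t φ).Λ → ℝ) → ℂ),
        (∀ b : ℝ, 0 < b → b ≤ γ → ∀ g ∈ W', ∀ j, θ ^ j < s → ∀ Z, ∀ t ∈ terms L M Z, ∀ φ, φ ∈ (W j).sp2 Z →
          ∀ z ∈ ball (0 : ℂ) (α j), ∀ i i',
            DifferentiableOn ℂ (fun σ => (𝒦 b g j Z t φ).A2 σ z i i')
              {σ | ∀ i, σ i ∈ ball (0 : ℂ) (Real.exp (c.κ₁ + 1))}) →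
        (∀ b : ℝ, 0 < b → b ≤ γ → ∀ g ∈ W', ∀ j, θ ^ j < s → ∀ Z, ∀ t ∈ terms L M Z, ∀ φ, φ ∈ (W j).sp2 Z →
          ∀ z ∈ ball (0 : ℂ) (α j), ∀ i i',
            DifferentiableOn ℂ (fun σ => (𝒦 b g j Z t φ).G2 σ z i i')
              {σ | ∀ i, σ i ∈ ball (0 : ℂ) (Real.exp (c.κ₁ + 1))}) →
        (∀ b : ℝ, 0 < b → b ≤ γ → ∀ g ∈ W', ∀ j, θ ^ j < s → ∀ Z, ∀ t ∈ terms L M Z, ∀ φ, φ ∈ (W j).sp2 Z →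
          ∀ Y Bf, DifferentiableOn ℂ (fun z => Vk b g j Z t φ z Y Bf) (ball (0 : ℂ) (α j))) →
        (∀ b : ℝ, 0 < b → b ≤ γ → ∀ g ∈ W', ∀ j Z t φ, Measurable (χY₀ b g j Z t φ)) →
        (∀ b : ℝ, 0 < b → b ≤ γ → ∀ g ∈ W', ∀ j Z t φ, Measurable (χcP b g j Z t φ)) →
        (∀ b : ℝ, 0 < b → b ≤ γ → ∀ g ∈ W', ∀ j, θ ^ j < s → ∀ Z, ∀ t ∈ terms L M Z, ∀ φ, φ ∈ (W j).sp2 Z →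
          ∀ z ∈ ball (0 : ℂ) (α j), ∀ Y, Measurable (Vk b g j Z t φ z Y)) →
        (∀ b : ℝ, 0 < b → b ≤ γ → ∀ g ∈ W', ∀ j, θ ^ j < s → ∀ Z, ∀ t ∈ terms L M Z, ∀ φ, φ ∈ (W j).sp2 Z →
          ∀ z : ℂ, ‖z‖ ≤ α j → ∀ σ : TPt 4 (N j) → ℂ, (∀ i, ‖σ i‖ ≤ Real.exp (c.κ₁ + 1)) →
            ((𝒦 b g j Z t φ).A2 σ z).IsSymm) →
        ∀ {w₂₀ : ℝ} (qP : (b : ℝ) → (g : ℕ → ℝ) → (j : ℕ) → (Z : TDom 4 (N j)) →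
            (t : Finset (TDom 4 (L * N j)) × Finset (TBond 4 M (L * N j))) → (φ : (W j).Φ) →
            ((𝒦 b g j Z t φ).Λ → ℝ) → ℝ),
        (∀ b : ℝ, 0 < b → b ≤ γ → ∀ g ∈ W', ∀ j Z t φ Bf, χY₀ b g j Z t φ Bf * χcP b g j Z t φ Bf ≤
          Real.exp (-(γ₂ / 2 * rP ^ 2 * (t.2.card : ℕ)) + γ₂ / 2 * qP b g j Z t φ Bf)) →
        (∀ b : ℝ, 0 < b → b ≤ γ → ∀ g ∈ W', ∀ j Z t φ Bf, qP b g j Z t φ Bf ≤ Bf ⬝ᵥ Bf) →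
        (∀ b : ℝ, 0 < b → b ≤ γ → ∀ g ∈ W', ∀ j, θ ^ j < s → ∀ Z, ∀ t ∈ terms L M Z, ∀ φ, φ ∈ (W j).sp2 Z →
          ∀ z ∈ ball (0 : ℂ) (α j), ∀ τ : TDom 4 (L * N j) → ℂ, (∀ Y, τ Y ∈ Uτ j Y) →
            ∀ Bf, ∑ Y ∈ Dfam b g j Z t, ‖τ Y‖ * ‖Vk b g j Z t φ z Y Bf‖ ≤ a₂₀ / 2 * (Bf ⬝ᵥ Bf) + w₂₀) →
        (∀ j, ∀ Z : TDom 4 (N j), w₂₀ ≤ w₀ * ((Z.1).card : ℝ)) →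
        (∀ b : ℝ, 0 < b → b ≤ γ → ∀ g ∈ W', ∀ j, θ ^ j < s → ∀ Z t φ, (𝒦 b g j Z t φ).m ≤ m) →
        (∀ b : ℝ, 0 < b → b ≤ γ → ∀ g ∈ W', ∀ j, θ ^ j < s → ∀ Z t φ, ∀ x : UT (Nf j),
          (Finset.univ.filter fun i => (𝒦 b g j Z t φ).locN i = x).card ≤ m) →
        (∀ b : ℝ, 0 < b → b ≤ γ → ∀ g ∈ W', ∀ j, θ ^ j < s → ∀ Z t φ,
          (Fintype.card (𝒦 b g j Z t φ).Λ : ℝ) ≤ nΛ * ((Z.1).card : ℝ)) →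
        (∀ b : ℝ, 0 < b → b ≤ γ → ∀ g ∈ W', ∀ j, θ ^ j < s → ∀ Z t φ,
          (Fintype.card ((𝒦 b g j Z t φ).Λ ⊕ (𝒦 b g j Z t φ).C₀) : ℝ) ≤ nN * ((Z.1).card : ℝ)) →
        ∀ {H : (b : ℝ) → (g : ℕ → ℝ) → (j : ℕ) → ℂ → TDom 4 (N j) → (W j).Φ → ℂ},
        (∀ b : ℝ, 0 < b → b ≤ γ → ∀ g ∈ W', ∀ j, θ ^ j < s → ∀ z ∈ ball (0 : ℂ) (α j),
          ∀ (Z : TDom 4 (N j)) (φ : (W j).Φ), φ ∈ (W j).sp2 Z →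
          H b g j z Z φ = ∑ t ∈ terms L M Z,
            term214 r (lZ j Z t) (lD j t) (core214 (fun σ => (𝒦 b g j Z t φ).A2 σ z) (Γ b g j Z t φ z)
              (F214 t.2.card (χY₀ b g j Z t φ) (χcP b g j Z t φ) (Dfam b g j Z t) (Vk b g j Z t φ z))) 0 0) →
        (∀ j, ∀ X Z : TDom 4 (N j), ∀ φ, Z.1 ⊆ X.1 → φ ∈ (W j).sp2 X → φ ∈ (W j).sp2 Z) →
        ∀ {E : (b : ℝ) → (g : ℕ → ℝ) → (j : ℕ) → ℂ → TDom 4 (N j) → (W j).Φ → ℂ},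
        (∀ b : ℝ, 0 < b → b ≤ γ → ∀ g ∈ W', ∀ j, θ ^ j < s → ∀ z ∈ ball (0 : ℂ) (α j),
          ∀ (X : TDom 4 (N j)) (φ : (W j).Φ), φ ∈ (W j).sp2 X →
          E b g j z X φ =
            locE (TTouch (d := 4) (N := N j)) (fun Z : TDom 4 (N j) => Z.1) (fun Z => H b g j z Z φ) X.1) →
        (∀ b : ℝ, 0 < b → b ≤ γ → ∀ g ∈ W', ∀ j (X : TDom 4 (N j)) (φ : (W j).Φ), φ ∈ (W j).sp2 X →
          ‖E b g j 0 X φ‖ ≤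
            c.A₂ * c.C3act * c.ε₁ * Real.exp (-((1 - 10 * c.δ) * ((c.L : ℝ) / 2) * c.κ * (tsys 4 (N j)).dj X))) →
        (∀ b : ℝ, 0 < b → b ≤ γ → ∀ g ∈ W', ∀ j (X : TDom 4 (N j)) (φ : (W j).Φ), φ ∈ (W j).sp2 X →
          ‖E b g j 1 X φ‖ ≤
            c.A₂ * c.C3act * c.ε₁ * Real.exp (-((1 - 10 * c.δ) * ((c.L : ℝ) / 2) * c.κ * (tsys 4 (N j)).dj X))) →
        -- the members ARE the coupling-indexed outputs of run A and of run B's family, on the spaces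
        ∀ (E₀ : (g : ℕ → ℝ) → (j : ℕ) → TDom 4 (N j) → (W j).Φ → ℂ)
          (E₁ : (b : ℝ) → (g : ℕ → ℝ) → (j : ℕ) → TDom 4 (N j) → (W j).Φ → ℂ),
        (∀ b : ℝ, 0 < b → b ≤ γ → ∀ g ∈ W', ∀ j (X : TDom 4 (N j)) (φ : (W j).Φ), φ ∈ (W j).sp2 X →
          E b g j 0 X φ = E₀ g j X φ) →
        (∀ b : ℝ, 0 < b → b ≤ γ → ∀ g ∈ W', ∀ j (X : TDom 4 (N j)) (φ : (W j).Φ), φ ∈ (W j).sp2 X →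
          E b g j 1 X φ = E₁ b g j X φ) →
        ∀ b : ℝ, 0 < b → b ≤ γ →
          NE5 (C := torusCarriers N W) (fun g => reFunctional N W (E₀ g) g) (fun g => reFunctional N W (E₁ b g) g)
            W' ((1 - 10 * c.δ) * ((c.L : ℝ) / 2) * c.κ) θ (2 * (c.A₂ * c.C3act * c.ε₁) / s) := by
  intro L _ hLL
  obtain ⟨c, hLc, hκ₁, hτ, hEND⟩ := ne5_end_final_all8 L hLL
  refine ⟨c, hLc, hκ₁, hτ, ?_⟩
  intro ν Nf _ KΓ KE KC ε κ hKΓ hKE hKC hε hκ m nΛ nN hnΛ hnN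
  obtain ⟨CR, Cσ, γ₂, a₂₀, w₀, hCR, hγ₂, ha₂₀, hw₀, hEND⟩ :=
    hEND (ν := ν) (Nf := Nf) hKΓ hKE hKC hε hκ m hnΛ hnN
  refine ⟨CR, Cσ, γ₂, a₂₀, w₀, hCR, hγ₂, ha₂₀, hw₀, ?_⟩
  intro θ s hθ hs Rσ₀ M _
  obtain ⟨w, α, rP, hw, hα1, hαs, hlett, hαeq, hReq, hRσeq, hEND⟩ := hEND hθ hs Rσ₀ M
  refine ⟨w, α, rP, hw, hα1, hαs, hlett, hαeq, hReq, hRσeq, ?_⟩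
  intro N _ W γ W' Uτ hUτ hUtau r hr hr' hsubτ lZ hlZ lD hlD 𝒦 _ _ h𝒦 Γ hlin χY₀ χcP hχ0 hχc0 Dfam Vk hAhol
    hGhol hVholb hχm hχcm hVm hAs w₂₀ qP h222 hqP h220U hw₂₀ hm hfibN hΛ hN H hH hsp E h213 hE0 hE1 E₀ E₁ hE₀ hE₁
    b hb hbγ g hg U X
  -- the END for the member `b` at the coupling sequence `g`, read at `g`
  have h := hEND N W hUτ hUtau hr hr' hsubτ lZ hlZ lD hlD (𝒦 b g) (h𝒦 b hb hbγ g hg) (Γ b g) (hlin b hb hbγ g hg)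
    (χY₀ b g) (χcP b g) (hχ0 b hb hbγ g hg) (hχc0 b hb hbγ g hg) (Dfam b g) (Vk b g) (hAhol b hb hbγ g hg)
    (hGhol b hb hbγ g hg) (hVholb b hb hbγ g hg) (hχm b hb hbγ g hg) (hχcm b hb hbγ g hg) (hVm b hb hbγ g hg)
    (hAs b hb hbγ g hg) (qP b g) (h222 b hb hbγ g hg) (hqP b hb hbγ g hg) (h220U b hb hbγ g hg) hw₂₀
    (hm b hb hbγ g hg) (hfibN b hb hbγ g hg) (hΛ b hb hbγ g hg) (hN b hb hbγ g hg) (hH b hb hbγ g hg) hsp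
    (h213 b hb hbγ g hg) (hE0 b hb hbγ g hg) (hE1 b hb hbγ g hg) W' g hg U X
  have e0 : reFunctional N W (fun j => E b g j 0) g ((torusCarriers N W).transport U) X =
      reFunctional N W (E₀ g) g ((torusCarriers N W).transport U) X :=
    reFunctional_congr N W (fun j X φ hφ => hE₀ b hb hbγ g hg j X φ hφ) g _ X
  have e1 : reFunctional N W (fun j => E b g j 1) g U X = reFunctional N W (E₁ b g) g U X :=
    reFunctional_congr N W (fun j X φ hφ => hE₁ b hb hbγ g hg j X φ hφ) g U X
  rw [e0, e1] at h
  exact h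

end Summit.QuantumFields.YangMills.BalabanUVNodes.N18End

end
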